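import Literature.Analysis.FluidPDE.NSHopfInvariant
import HarnessLib

/-!
# Hopf's existence theorem on `𝕋³` in the closed class of parallel shear flows
  `u = (u₁(x₂,t), 0, u₃(x₁,x₂,t))` (the "two-and-half Navier–Stokes" ansatz of
  Bardos–Titi–Wiedemann 2012)

Trunk: FluidKinetic. Companion to `Literature/Analysis/FluidPDE/NSHopfInvariant` (Hopf's
Faedo–Galerkin existence proof run in the closed subspace of `x₃`-independent fields). Here the
same proof is run in the finer closed subspace of **parallel shear fields**
`u(x) = (u₁(x₂), 0, u₃(x₁,x₂))` (paper coordinates `x₁,x₂,x₃` ↦ indices `0,1,2`), the ansatz of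
Bardos–Titi–Wiedemann, C. R. Math. 350 (2012), proof of Thm. 5: "The intuition that the
solution of Navier-Stokes should preserve the particular structure of the initial data leads us
to the ansatz `u^ν(x,t) = (u₁^ν(x₂,t), 0, u₃^ν(x₁,x₂,t))` and `p^ν = 0` … Inserting this into the
Navier-Stokes equations gives the so called two-and-half Navier-Stokes equations … Hence, for
every fixed `ν > 0`, we obtain a Leray-Hopf weak solution with the initial data `v₀(x)`." The
printed route is the heat equation for `u₁^ν` and an advection–diffusion equation for `u₃^ν`
(DiPerna–Majda 1987; Evans, §7.1.3); the route taken here is the equivalent Fourier–Galerkin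
one already in the tree: the Galerkin vector field maps the shear subspace to itself, so Hopf's
construction (Hopf 1951, §§2–4; Robinson–Rodrigo–Sadowski 2016, Thm. 4.4) never leaves it, and
the limit `L²` class has an everywhere-shear representative.

On Fourier coefficients `c : ℤ³ → ℂ³` the shear class is cut out by three linear conditions:
(S2) `c k = 0` whenever `k₂ ≠ 0` (no dependence on `x₃`), (Z1) `(c k)₁ = 0` (no second
component), (S0) `(c k)₀ = 0` whenever `k₀ ≠ 0` (the first component depends on `x₂` only).

## Contents (all proved)

* `convectionCoeff_apply_one_eq_zero`, `convectionCoeff_apply_zero_eq_zero`,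
  `galerkinField_shear` — **the Galerkin vector field preserves the shear class**: in the
  class the convection symbol `∑_{l+m=k} (2πi c_l·m) c_m` is `(0, 0, *)`-valued with no output
  at `k₀ ≠ 0` in the first slot, and the Leray symbol acts as the identity because
  `k·w = k₀w₀ + k₂w₂ = 0` there (the Fourier form of "`(u·∇)u = (0,0,u₁∂₁u₃)`, `p = 0`" for shear
  fields; Bardos–Titi–Wiedemann 2012, proof of Thm. 5; Majda–Bertozzi 2002, §2.3.1).
* `coeffExt_shear` — bookkeeping: extension by zero keeps the class.
* `exists_isHopfGalerkinScheme_shear` — for an unforced datum `u₀ ∈ L²_σ(𝕋³)` whose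
  coefficients are in the shear class there is a Hopf–Galerkin scheme (`IsHopfGalerkinScheme`,
  force `0`) all of whose approximations have coefficients in the shear class
  (`exists_galerkin_solution_of_invariant` in `galerkinSubspace ⊓` shear class, the latter
  built inline as a real subspace of the coefficient vectors).
* `Torus.axisAvg_add_right`, `Torus.apply_eq_of_forall_add_single₀₂`,
  `Torus.apply_eq_of_forall_add_single₂`, `Torus.mFourierCoeff_fun_zero` — bookkeeping for
  fields invariant under axis translations on `𝕋³` and for zero fields.
* `IsHopfGalerkinScheme.exists_shear_limitField` — **the shear limit field**: for a scheme
  whose approximations have shear coefficients, the limit field of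
  `IsHopfGalerkinScheme.exists_limitField` may be taken *literally* of the form
  `fun t x => (a t (x 1), 0, c t (x 0, x 1))`, with the same standing properties (measurable
  lift, `L²` slices, coefficientwise convergence for `t ≥ 0`): the limit coefficients are in the
  class (limits), and the `L²` class of each slice is represented through the axis averages
  `Torus.axisAvg` (`NSHopfInvariant`, `TorusAxisAverage`).
* `exists_isGlobalLerayHopf_shear` — **Hopf's theorem in the shear class**: for `ν > 0` and
  such `u₀` there are `a`, `c` with `(t,x) ↦ (a t (x 1), 0, c t (x 0, x 1))` a global Leray–Hopf
  weak solution of the unforced Navier–Stokes equations with datum `u₀`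
  (`IsHopfGalerkinScheme.isLerayHopfOn_limit` of `NSHopfGalerkinLimit`).

No new definitions: the shear class is carried as three explicit hypotheses on coefficient
families, so that users state exactly the structure they have.

The application to the shear data `(v₁(x₂), 0, v₃(x₁,x₂))` of Bardos–Titi–Wiedemann (discharge
of `Literature.Barriers.AnomalousDissipation.BardosTitiWiedemann2012_thm5_shearLerayHopf`) is in
`Literature/Barriers/AnomalousDissipation/ShearFlowViscositySelectionStepsProofs`.

## Mathlib search

Mathlib (this pin) has no Navier–Stokes / Galerkin material (searched `Galerkin`, `NavierStokes`,
`LerayHopf`: only `Literature/`); everything rests on `NSHopfInvariant`, `NSHopfLimit`,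
`NSHopfGalerkinLimit`, `TorusAxisAverage`.

## References

* C. Bardos, E. S. Titi, E. Wiedemann, C. R. Math. Acad. Sci. Paris 350 (2012) 757–760, Thm. 5
  and its proof (`BardosTitiWiedemann2012`).
* E. Hopf, Math. Nachr. 4 (1951) 213–231, §§2–4 (`Hopf1951`).
* J. C. Robinson, J. L. Rodrigo, W. Sadowski, *The three-dimensional Navier–Stokes equations*
  (CUP 2016), Thm. 4.4, Thm. 4.6, Cor. 4.7, Thm. 4.11 (`RobinsonRodrigoSadowski2016`).
* A. J. Majda, A. L. Bertozzi, *Vorticity and Incompressible Flow* (CUP 2002), §2.3.1, Prop. 2.7.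
* R. J. DiPerna, A. J. Majda, Comm. Math. Phys. 108 (1987) 667–689 (`DiPernaMajda1987`).
-/

open MeasureTheory Set Filter Topology UnitAddTorus Metric Function
open scoped ENNReal NNReal InnerProductSpace

noncomputable section

namespace Literature.Analysis.FluidPDE

section NS

open FunctionSpaces.Torus Torus

/-! ## The Galerkin vector field preserves the shear class -/

section Field

variable {S : Finset (Fin 3 → ℤ)}

/-- **The convection symbol has no second component in the shear class**: if every `c' m` has
vanishing component `1`, so does `convectionCoeff S c c' k = ∑_{l+m=k} (2πi c_l·m) c'_m` (each
summand is a scalar multiple of some `c' m`). Fourier form of "`((u·∇)v)₂ = (u·∇)v₂ = 0` when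
`v₂ = 0`". [folklore] -/
theorem convectionCoeff_apply_one_eq_zero {c c' : (Fin 3 → ℤ) → EuclideanSpace ℂ (Fin 3)}
    (hc' : ∀ m, c' m 1 = 0) (k : Fin 3 → ℤ) :
    convectionCoeff S c c' k 1 = 0 := by
  simp only [convectionCoeff_def, WithLp.ofLp_sum, Finset.sum_apply]
  refine Finset.sum_eq_zero fun l _ => Finset.sum_eq_zero fun m _ => ?_
  split_ifs
  · rw [PiLp.smul_apply, hc' m, smul_zero]
  · rfl

/-- **The convection symbol has no first component at frequencies `k₀ ≠ 0` in the shear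
class.** If `c` has no modes with `m₂ ≠ 0` (S2), vanishing component `1` (Z1) and vanishing
component `0` at all `m₀ ≠ 0` (S0), then `(convectionCoeff S c c k)₀ = 0` whenever `k₀ ≠ 0`: in a
summand `(2πi c_l·m) (c_m)₀` with `l + m = k`, either `m₀ ≠ 0` (so `(c_m)₀ = 0`), or `m₀ = 0`,
`l₀ ≠ 0` and `c_l·m = (c_l)₀m₀ + (c_l)₁m₁ + (c_l)₂m₂ = (c_l)₂m₂`, which vanishes unless `m₂ ≠ 0`,
in which case `c_m = 0`. Fourier form of "`((u·∇)u)₁ = u₁∂₁u₁(x₂) + u₃∂₃u₁(x₂) = 0`" for shear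
fields (Bardos–Titi–Wiedemann 2012, proof of Thm. 5). [folklore] -/
theorem convectionCoeff_apply_zero_eq_zero {c : (Fin 3 → ℤ) → EuclideanSpace ℂ (Fin 3)}
    (h2 : ∀ m, m 2 ≠ 0 → c m = 0) (h1 : ∀ m, c m 1 = 0) (h0 : ∀ m, m 0 ≠ 0 → c m 0 = 0)
    {k : Fin 3 → ℤ} (hk : k 0 ≠ 0) :
    convectionCoeff S c c k 0 = 0 := by
  simp only [convectionCoeff_def, WithLp.ofLp_sum, Finset.sum_apply]
  refine Finset.sum_eq_zero fun l _ => Finset.sum_eq_zero fun m _ => ?_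
  split_ifs with hlm
  · rw [PiLp.smul_apply, smul_eq_mul]
    by_cases hm0 : m 0 = 0
    · by_cases hm2 : m 2 = 0
      · have hl0 : l 0 ≠ 0 := by
          intro hl
          apply hk
          rw [← hlm, Pi.add_apply, hl, hm0, add_zero]
        have hsum : ∑ j, c l j * (m j : ℂ) = 0 := by
          rw [Fin.sum_univ_three, h0 l hl0, h1 l, hm0, hm2]
          push_cast
          ring
        rw [hsum, mul_zero, zero_mul]
      · rw [h2 m hm2, PiLp.zero_apply, mul_zero]
    · rw [h0 m hm0, mul_zero]
  · rfl

/-- **The Galerkin vector field preserves the shear class** (Fourier form of the reduction of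
Navier–Stokes to the "two-and-half Navier–Stokes equations" with `p = 0` for the ansatz
`(u₁(x₂), 0, u₃(x₁,x₂))`, Bardos–Titi–Wiedemann 2012, proof of Thm. 5; Majda–Bertozzi 2002,
§2.3.1): if the force coefficients `g` and the state coefficients `c` satisfy (S2) no modes with
`k₂ ≠ 0`, (Z1) vanishing component `1`, (S0) vanishing component `0` at `k₀ ≠ 0`, then so does
`galerkinField ν S g c`. The Stokes term is diagonal; on `w = g k - convectionCoeff S c c k` the
Leray symbol is the identity since `∑ᵢ kᵢwᵢ = k₀w₀ + k₂w₂ = 0` (`k₂ = 0` in the class, and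
`k₀w₀ = 0` by (S0)). [cite: BardosTitiWiedemann2012, Thm. 5, proof] -/
theorem galerkinField_shear (ν : ℝ) {g c : (Fin 3 → ℤ) → EuclideanSpace ℂ (Fin 3)}
    (hg2 : ∀ k, k 2 ≠ 0 → g k = 0) (hg1 : ∀ k, g k 1 = 0) (hg0 : ∀ k, k 0 ≠ 0 → g k 0 = 0)
    (hc2 : ∀ k, k 2 ≠ 0 → c k = 0) (hc1 : ∀ k, c k 1 = 0) (hc0 : ∀ k, k 0 ≠ 0 → c k 0 = 0) :
    (∀ k, k 2 ≠ 0 → galerkinField ν S g c k = 0) ∧ (∀ k, galerkinField ν S g c k 1 = 0) ∧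
      ∀ k, k 0 ≠ 0 → galerkinField ν S g c k 0 = 0 := by
  have hA : ∀ k : Fin 3 → ℤ, k 2 ≠ 0 → galerkinField ν S g c k = 0 := fun k hk =>
    galerkinField_eq_zero_of_apply_ne_zero ν hg2 hc2 hk
  have hw1 : ∀ k, (g k - convectionCoeff S c c k) 1 = 0 := fun k => by
    rw [PiLp.sub_apply, hg1 k, convectionCoeff_apply_one_eq_zero hc1 k, sub_zero]
  have hw0 : ∀ k : Fin 3 → ℤ, k 0 ≠ 0 → (g k - convectionCoeff S c c k) 0 = 0 := fun k hk => by
    rw [PiLp.sub_apply, hg0 k hk, convectionCoeff_apply_zero_eq_zero hc2 hc1 hc0 hk, sub_zero]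
  -- in the class the Leray symbol acts as the identity
  have hler : ∀ k : Fin 3 → ℤ, k 2 = 0 →
      leraySym k (g k - convectionCoeff S c c k) = g k - convectionCoeff S c c k := by
    intro k hk2
    refine leraySym_of_transversal ?_
    rw [Fin.sum_univ_three, hw1 k, hk2, mul_zero, add_zero, Int.cast_zero, zero_mul, add_zero]
    by_cases hk0 : k 0 = 0
    · rw [hk0, Int.cast_zero, zero_mul]
    · rw [hw0 k hk0, mul_zero]
  refine ⟨hA, fun k => ?_, fun k hk => ?_⟩
  · by_cases hk2 : k 2 = 0
    · rw [galerkinField_def, hler k hk2, PiLp.add_apply, PiLp.neg_apply, PiLp.smul_apply, hc1 k,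
        hw1 k, smul_zero, neg_zero, add_zero]
    · rw [hA k hk2, PiLp.zero_apply]
  · by_cases hk2 : k 2 = 0
    · rw [galerkinField_def, hler k hk2, PiLp.add_apply, PiLp.neg_apply, PiLp.smul_apply,
        hc0 k hk, hw0 k hk, smul_zero, neg_zero, add_zero]
    · rw [hA k hk2, PiLp.zero_apply]

/-- Extension by zero keeps the shear class: if a coefficient vector `c` on `S` satisfies
(S2), (Z1), (S0) at every `k ∈ S`, its extension `coeffExt S c` satisfies them at every `k ∈ ℤ³`
(off `S` it vanishes). [folklore] -/
theorem coeffExt_shear {c : ↥S → EuclideanSpace ℂ (Fin 3)}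
    (hc : ∀ k : ↥S,
      ((k : Fin 3 → ℤ) 2 ≠ 0 → c k = 0) ∧ c k 1 = 0 ∧ ((k : Fin 3 → ℤ) 0 ≠ 0 → c k 0 = 0)) :
    (∀ k : Fin 3 → ℤ, k 2 ≠ 0 → coeffExt S c k = 0) ∧ (∀ k : Fin 3 → ℤ, coeffExt S c k 1 = 0) ∧
      ∀ k : Fin 3 → ℤ, k 0 ≠ 0 → coeffExt S c k 0 = 0 := by
  refine ⟨fun k hk => ?_, fun k => ?_, fun k hk => ?_⟩
  · by_cases hkS : k ∈ S
    · rw [coeffExt_of_mem _ hkS]; exact (hc ⟨k, hkS⟩).1 hk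
    · exact coeffExt_of_not_mem _ hkS
  · by_cases hkS : k ∈ S
    · rw [coeffExt_of_mem _ hkS]; exact (hc ⟨k, hkS⟩).2.1
    · rw [coeffExt_of_not_mem _ hkS, PiLp.zero_apply]
  · by_cases hkS : k ∈ S
    · rw [coeffExt_of_mem _ hkS]; exact (hc ⟨k, hkS⟩).2.2 hk
    · rw [coeffExt_of_not_mem _ hkS, PiLp.zero_apply]

end Field

/-! ## The Hopf–Galerkin scheme in the shear class -/

section Scheme

/-- **Existence of a Hopf–Galerkin scheme in the shear class** (Hopf 1951, §§2–3;
Robinson–Rodrigo–Sadowski 2016, Thm. 4.4, Steps 1–2 — run in the closed subspace of parallel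
shear fields, Bardos–Titi–Wiedemann 2012, proof of Thm. 5). Let `ν > 0` and let
`u₀ ∈ L²(𝕋³; ℝ³)` be weakly divergence free with Fourier coefficients in the shear class:
`û₀(k) = 0` for `k₂ ≠ 0`, `û₀(k)₁ = 0`, and `û₀(k)₀ = 0` for `k₀ ≠ 0`. Then there is a
Hopf–Galerkin scheme `(N, F, U)` for the unforced problem `(ν, 0, u₀)` (`NS.IsHopfGalerkinScheme`)
such that the Fourier coefficients of every approximation `U n t` are in the shear class.
Construction: `N = id`, `F n = 0` (the real trigonometric polynomial with zero coefficients), and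
`U n` the global solution of the `n`-th Galerkin ODE inside `galerkinSubspace ⊓` (shear class)
(`exists_galerkin_solution_of_invariant`, `galerkinField_shear`) from the datum
`(û₀(k))_{|k| ≤ n}`; the clauses of the scheme exactly as in `NS.exists_isHopfGalerkinScheme`,
the coefficients of `U n t` read off by `Torus.mFourierCoeff_realTrigPoly`. [cite: RobinsonRodrigoSadowski2016, Thm. 4.4 Steps 1–2] -/
theorem exists_isHopfGalerkinScheme_shear (ν : ℝ) (hν : 0 < ν)
    (u₀ : UnitAddTorus (Fin 3) → EuclideanSpace ℝ (Fin 3))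
    (hu₀ : MemLp u₀ 2 volume) (hdiv : FunctionSpaces.Torus.IsWeaklyDivFree u₀)
    (h2 : ∀ k : Fin 3 → ℤ, k 2 ≠ 0 → mFourierCoeff (FunctionSpaces.EuclideanSpace.complexify ∘ u₀) k = 0)
    (h1 : ∀ k : Fin 3 → ℤ, mFourierCoeff (FunctionSpaces.EuclideanSpace.complexify ∘ u₀) k 1 = 0)
    (h0 : ∀ k : Fin 3 → ℤ, k 0 ≠ 0 → mFourierCoeff (FunctionSpaces.EuclideanSpace.complexify ∘ u₀) k 0 = 0) :
    ∃ (N : ℕ → ℕ) (F U : ℕ → ℝ → UnitAddTorus (Fin 3) → EuclideanSpace ℝ (Fin 3)),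
      IsHopfGalerkinScheme ν 0 u₀ N F U ∧
      ∀ n (t : ℝ),
        (∀ k : Fin 3 → ℤ, k 2 ≠ 0 → mFourierCoeff (FunctionSpaces.EuclideanSpace.complexify ∘ U n t) k = 0) ∧
        (∀ k : Fin 3 → ℤ, mFourierCoeff (FunctionSpaces.EuclideanSpace.complexify ∘ U n t) k 1 = 0) ∧
        (∀ k : Fin 3 → ℤ, k 0 ≠ 0 → mFourierCoeff (FunctionSpaces.EuclideanSpace.complexify ∘ U n t) k 0 = 0) := by
  have hS : ∀ n : ℕ, ∀ k ∈ freqBall (d := Fin 3) n, -k ∈ freqBall n := fun n =>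
    neg_mem_freqBall_of_mem
  -- zero force coefficients
  set g' : (n : ℕ) → ℝ → (↥(freqBall (d := Fin 3) n) → EuclideanSpace ℂ (Fin 3)) :=
    fun n _ => 0 with hg'_def
  have hg'_smooth : ∀ n, ContDiff ℝ ((⊤ : ℕ∞) : WithTop ℕ∞) (g' n) := fun n => contDiff_const
  have hg'_real : ∀ n t, IsRealCoeff (g' n t) := fun n t k l _ => by
    simp only [hg'_def, Pi.zero_apply, FunctionSpaces.EuclideanSpace.conjVec_zero]
  have hg'_cont : ∀ n, Continuous (g' n) := fun n => continuous_const
  have hg'_ext : ∀ n t, coeffExt (freqBall n) (g' n t) = 0 := fun n t => coeffExt_zero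
  -- the shear subspaces of the Galerkin phase spaces
  let W : (n : ℕ) → Submodule ℝ (↥(freqBall (d := Fin 3) n) → EuclideanSpace ℂ (Fin 3)) :=
    fun n =>
    { carrier := {c | c ∈ galerkinSubspace (freqBall n) ∧ ∀ k : ↥(freqBall n),
        (((k : Fin 3 → ℤ) 2 ≠ 0 → c k = 0) ∧ c k 1 = 0 ∧ ((k : Fin 3 → ℤ) 0 ≠ 0 → c k 0 = 0))}
      zero_mem' := ⟨Submodule.zero_mem _, fun k => ⟨fun _ => rfl, rfl, fun _ => rfl⟩⟩
      add_mem' := by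
        rintro c c' ⟨hc, hck⟩ ⟨hc', hc'k⟩
        refine ⟨Submodule.add_mem _ hc hc', fun k => ⟨fun hk => ?_, ?_, fun hk => ?_⟩⟩
        · rw [Pi.add_apply, (hck k).1 hk, (hc'k k).1 hk, add_zero]
        · rw [Pi.add_apply, PiLp.add_apply, (hck k).2.1, (hc'k k).2.1, add_zero]
        · rw [Pi.add_apply, PiLp.add_apply, (hck k).2.2 hk, (hc'k k).2.2 hk, add_zero]
      smul_mem' := by
        rintro a c ⟨hc, hck⟩
        refine ⟨Submodule.smul_mem _ a hc, fun k => ⟨fun hk => ?_, ?_, fun hk => ?_⟩⟩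
        · rw [Pi.smul_apply, (hck k).1 hk, smul_zero]
        · rw [Pi.smul_apply, PiLp.smul_apply, (hck k).2.1, smul_zero]
        · rw [Pi.smul_apply, PiLp.smul_apply, (hck k).2.2 hk, smul_zero] }
  have hWle : ∀ n, W n ≤ galerkinSubspace (freqBall n) := fun n c hc => hc.1
  have hWinv : ∀ n t, ∀ c ∈ W n, galerkinRHS (freqBall n) ν (g' n t) c ∈ W n := by
    intro n t c hc
    refine ⟨galerkinRHS_mem ν (hS n) (hg'_real n t) hc.1, ?_⟩
    obtain ⟨hc2, hc1, hc0⟩ := coeffExt_shear hc.2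
    obtain ⟨hA, hB, hC⟩ := galerkinField_shear ν (S := freqBall n)
      (g := coeffExt (freqBall n) (g' n t)) (fun k _ => by rw [hg'_ext n t]; rfl)
      (fun k => by rw [hg'_ext n t]; rfl) (fun k _ => by rw [hg'_ext n t]; rfl) hc2 hc1 hc0
    exact fun k => ⟨fun hk => hA k hk, hB k, fun hk => hC k hk⟩
  -- the data of the Galerkin systems: `(û₀(k))_{|k| ≤ n}`, inside the shear subspaces
  set c₀ : (n : ℕ) → ↥(freqBall (d := Fin 3) n) → EuclideanSpace ℂ (Fin 3) :=
    fun n k => mFourierCoeff (FunctionSpaces.EuclideanSpace.complexify ∘ u₀) k with hc₀_def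
  have hc₀ : ∀ n, c₀ n ∈ W n := fun n =>
    ⟨⟨isRealCoeff_mFourierCoeff (hu₀.integrable one_le_two),
      isSolenoidalCoeff_restrict (hdiv.isTransversal_mFourierCoeff hu₀ (freqBall n))⟩,
      fun k => ⟨fun hk => h2 k hk, h1 k, fun hk => h0 k hk⟩⟩
  -- the global Galerkin solutions
  have hsol : ∀ n : ℕ, ∃ α : ℝ → ↥(freqBall (d := Fin 3) n) → EuclideanSpace ℂ (Fin 3),
      α 0 = c₀ n ∧ (∀ t, α t ∈ W n) ∧ ContinuousOn α (Ici 0) ∧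
      ∀ T, ∀ t ∈ Icc 0 T, HasDerivWithinAt α (galerkinRHS (freqBall n) ν (g' n t) (α t))
        (Icc 0 T) t := fun n =>
    exists_galerkin_solution_of_invariant ν hν.le (hS n) (hg'_cont n) (hg'_real n) (W n) (hWle n)
      (hWinv n) (hc₀ n)
  choose α hα0 hαW hαcont hαderiv using hsol
  have hαmem : ∀ n t, α n t ∈ galerkinSubspace (freqBall n) := fun n t => hWle n (hαW n t)
  -- the scheme
  refine ⟨id, fun n t => realTrigPoly (freqBall n) (coeffExt (freqBall n) (g' n t)),
    fun n t => realTrigPoly (freqBall n) (coeffExt (freqBall n) (α n t)), ?_, ?_⟩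
  · -- the datum is the Fourier truncation
    have hU0 : ∀ n, realTrigPoly (freqBall n) (coeffExt (freqBall n) (α n 0)) =
        fourierTruncate n u₀ := by
      intro n
      rw [hα0 n, fourierTruncate_eq]
      exact realTrigPoly_coeffExt_restrict _
    -- band-limitation of Galerkin modes in `Finset` form
    have hband : ∀ {n : ℕ} {a : UnitAddTorus (Fin 3) → EuclideanSpace ℝ (Fin 3)},
        IsGalerkinMode n a → ∀ k ∉ freqBall (d := Fin 3) n,
          mFourierCoeff (FunctionSpaces.EuclideanSpace.complexify ∘ a) k = 0 :=
      fun ha k hk => ha.mFourierCoeff_eq_zero (not_mem_freqBall.1 hk)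
    exact
      { tendsto_order := tendsto_id
        smooth_force := fun n => contDiff_stLift_realTrigPoly (hg'_smooth n)
        tendsto_force := fun T hT => by
          have h : (fun n : ℕ => ∫⁻ t in Ioo 0 T, ∫⁻ x,
              ‖realTrigPoly (freqBall n) (coeffExt (freqBall n) (g' n t)) x -
                (0 : ℝ → UnitAddTorus (Fin 3) → EuclideanSpace ℝ (Fin 3)) t x‖ₑ ^ 2) = fun _ => 0 := by
            funext n
            simp [hg'_ext n]
          rw [h]
          exact tendsto_const_nhds
        continuousOn := fun n => continuousOn_stLift_realTrigPoly (hαcont n)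
        isGalerkinMode := fun n t _ =>
          have h := galerkin_slice_props (hS n) (hαmem n t)
          ⟨h.1, h.2.1, fun k hk => h.2.2.2 k (not_mem_freqBall.2 hk)⟩
        isWeaklyDivFree := fun n t _ => (galerkin_slice_props (hS n) (hαmem n t)).2.2.1
        galerkin := fun n a ha s t hs hst =>
          galerkin_test_identity ν (hS n) (hg'_cont n) (hg'_real n) (hαmem n) (hαderiv n)
            ha.isSmooth ha.isDivFree (hband ha) hs hst
        energy_eq := fun n s t hs hst =>
          galerkin_energy_identity ν (hS n) (hg'_cont n) (hg'_real n) (hαmem n) (hαderiv n) hs hst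
        initial_inner := fun n a ha => by
          rw [hU0 n]
          exact integral_inner_fourierTruncate_eq hu₀ (ha.isSmooth.memLp 2) (hband ha)
        tendsto_initial := by
          have heq : (fun n => eLpNorm (realTrigPoly (freqBall n)
              (coeffExt (freqBall n) (α n 0)) - u₀) 2 volume) =
              fun n => eLpNorm (fourierTruncate n u₀ - u₀) 2 volume := by
            funext n; rw [hU0 n]
          rw [heq]
          exact tendsto_eLpNorm_fourierTruncate_sub hu₀ }
  · -- the coefficients of the approximations are in the shear class
    intro n t
    have hcoef : ∀ k : Fin 3 → ℤ, mFourierCoeff (FunctionSpaces.EuclideanSpace.complexify ∘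
        realTrigPoly (freqBall n) (coeffExt (freqBall n) (α n t))) k =
          coeffExt (freqBall n) (α n t) k := by
      intro k
      rw [mFourierCoeff_realTrigPoly (hS n) ((hαmem n t).1.isConjSymm_coeffExt (hS n))]
      by_cases hk : k ∈ freqBall n
      · rw [if_pos hk]
      · rw [if_neg hk, coeffExt_of_not_mem _ hk]
    obtain ⟨hc2, hc1, hc0⟩ := coeffExt_shear (hαW n t).2
    refine ⟨fun k hk => ?_, fun k => ?_, fun k hk => ?_⟩
    · rw [hcoef k]; exact hc2 k hk
    · rw [hcoef k]; exact hc1 k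
    · rw [hcoef k]; exact hc0 k hk

end Scheme

/-! ## Fields on `𝕋³` invariant under axis translations: bookkeeping -/

section Invariance

/-- Translating the base point passes through the axis average:
`axisAvg i v (x + y) = axisAvg i (v (· + y)) x` (commutativity of addition in `T^d`; no
integrability needed). [folklore] -/
theorem Torus.axisAvg_add_right {d : Type*} [DecidableEq d] {F : Type*} [NormedAddCommGroup F]
    [NormedSpace ℝ F] (i : d) (v : UnitAddTorus d → F) (x y : UnitAddTorus d) :
    axisAvg i v (x + y) = axisAvg i (fun z => v (z + y)) x := by
  rw [axisAvg_apply, axisAvg_apply]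
  congr 1
  funext s
  rw [add_right_comm]

/-- A map on `𝕋³` invariant under all translations along the axes `0` and `2` depends on the
coordinate `x 1` only: `G x = G (0, x 1, 0)`. [folklore] -/
theorem Torus.apply_eq_of_forall_add_single₀₂ {F : Type*} {G : UnitAddTorus (Fin 3) → F}
    (h0 : ∀ (s : UnitAddCircle) (x : UnitAddTorus (Fin 3)), G (x + Pi.single 0 s) = G x)
    (h2 : ∀ (s : UnitAddCircle) (x : UnitAddTorus (Fin 3)), G (x + Pi.single 2 s) = G x)
    (x : UnitAddTorus (Fin 3)) : G x = G ![0, x 1, 0] := by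
  have hx : (![0, x 1, 0] : UnitAddTorus (Fin 3)) + Pi.single 0 (x 0) + Pi.single 2 (x 2) = x := by
    funext i
    rw [Pi.add_apply, Pi.add_apply]
    fin_cases i <;> simp
  calc G x = G ((![0, x 1, 0] : UnitAddTorus (Fin 3)) + Pi.single 0 (x 0) + Pi.single 2 (x 2)) := by
        rw [hx]
    _ = G ![0, x 1, 0] := by rw [h2, h0]

/-- A map on `𝕋³` invariant under all translations along the axis `2` depends on the
coordinates `x 0, x 1` only: `G x = G (x 0, x 1, 0)`. [folklore] -/
theorem Torus.apply_eq_of_forall_add_single₂ {F : Type*} {G : UnitAddTorus (Fin 3) → F}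
    (h2 : ∀ (s : UnitAddCircle) (x : UnitAddTorus (Fin 3)), G (x + Pi.single 2 s) = G x)
    (x : UnitAddTorus (Fin 3)) : G x = G ![x 0, x 1, 0] := by
  have hx : (![x 0, x 1, 0] : UnitAddTorus (Fin 3)) + Pi.single 2 (x 2) = x := by
    funext i
    rw [Pi.add_apply]
    fin_cases i <;> simp
  calc G x = G ((![x 0, x 1, 0] : UnitAddTorus (Fin 3)) + Pi.single 2 (x 2)) := by rw [hx]
    _ = G ![x 0, x 1, 0] := by rw [h2]

/-- The Fourier coefficients of the zero function vanish. [folklore] -/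
theorem Torus.mFourierCoeff_fun_zero {d : Type*} [Fintype d] {E : Type*} [NormedAddCommGroup E]
    [NormedSpace ℂ E] (k : d → ℤ) : mFourierCoeff (fun _ : UnitAddTorus d => (0 : E)) k = 0 := by
  simp [mFourierCoeff]

end Invariance

/-! ## The shear limit field of a shear scheme -/

section Limit

variable {ν : ℝ} {u₀ : UnitAddTorus (Fin 3) → EuclideanSpace ℝ (Fin 3)} {N : ℕ → ℕ}
  {F U : ℕ → ℝ → UnitAddTorus (Fin 3) → EuclideanSpace ℝ (Fin 3)}

/-- **The shear limit field of a shear Hopf–Galerkin scheme** (Hopf 1951, §4;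
Robinson–Rodrigo–Sadowski 2016, Thm. 4.4 Step 3 and Thm. 4.11 — in the closed subspace of
parallel shear fields `(u₁(x₂), 0, u₃(x₁,x₂))`, Bardos–Titi–Wiedemann 2012, proof of Thm. 5).
For an unforced scheme with `ν ≥ 0`, `u₀ ∈ L²`, all of whose approximations `U n t`, `t ≥ 0`, have
Fourier coefficients in the shear class ((S2) no modes `k₂ ≠ 0`, (Z1) no second component,
(S0) first component without modes `k₀ ≠ 0`), there are a subsequence `φ` and a real field `u`
with measurable space–time lift on `(0,∞) × 𝕋³`, `u t ∈ L²` and `Û_{φ j}(t,k) → û(t,k)` for every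
`t ≥ 0` and every `k` — exactly the output of `IsHopfGalerkinScheme.exists_limitField` — which is
**literally of the shear form** `u t x = (a t (x 1), 0, c t (x 0, x 1))`. Proof: the limit
coefficients of `exists_limitField` are in the class for `t ≥ 0` (limits); the `x₃`-average
`w t = axisAvg 2 (u t)` agrees a.e. with `u t` (`Torus.translate_ae_eq_of_mFourierCoeff_eq_zero`,
`Torus.axisAvg_ae_eq_of_forall_translate_ae_eq`) and is everywhere `x₃`-independent; its second
component is a.e. zero and the `x₁`-average of its first component agrees a.e. with it (same
lemmas applied to `(w₀, 0, 0)`, Fourier uniqueness `Torus.ae_eq_of_mFourierCoeff_complexify_eq`);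
the field `((axisAvg 0 (w₀,0,0))₀, 0, w₂)` is then in the same `L²` class for every `t ≥ 0`, has
a measurable lift (`Torus.aestronglyMeasurable_stLift_axisAvg`), and is of the shear form at
every point. [cite: RobinsonRodrigoSadowski2016, Thm. 4.4 Step 3, Thm. 4.11] -/
theorem IsHopfGalerkinScheme.exists_shear_limitField (hS : IsHopfGalerkinScheme ν 0 u₀ N F U)
    (hν : 0 ≤ ν) (hu₀ : MemLp u₀ 2 volume)
    (hU : ∀ n (t : ℝ), 0 ≤ t →
      (∀ k : Fin 3 → ℤ, k 2 ≠ 0 → mFourierCoeff (FunctionSpaces.EuclideanSpace.complexify ∘ U n t) k = 0) ∧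
      (∀ k : Fin 3 → ℤ, mFourierCoeff (FunctionSpaces.EuclideanSpace.complexify ∘ U n t) k 1 = 0) ∧
      (∀ k : Fin 3 → ℤ, k 0 ≠ 0 → mFourierCoeff (FunctionSpaces.EuclideanSpace.complexify ∘ U n t) k 0 = 0)) :
    ∃ φ : ℕ → ℕ, StrictMono φ ∧ ∃ u : ℝ → UnitAddTorus (Fin 3) → EuclideanSpace ℝ (Fin 3),
      AEStronglyMeasurable (FunctionSpaces.Torus.stLift u) (volume.restrict (Ioi 0 ×ˢ univ)) ∧
      (∀ t, 0 ≤ t → MemLp (u t) 2 volume) ∧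
      (∀ t, 0 ≤ t → ∀ k, Tendsto
        (fun j => mFourierCoeff (FunctionSpaces.EuclideanSpace.complexify ∘ U (φ j) t) k) atTop
        (𝓝 (mFourierCoeff (FunctionSpaces.EuclideanSpace.complexify ∘ u t) k))) ∧
      ∃ (a : ℝ → UnitAddCircle → ℝ) (c : ℝ → UnitAddTorus (Fin 2) → ℝ),
        u = fun t x => !₂[a t (x 1), 0, c t ![x 0, x 1]] := by
  have hfm : AEStronglyMeasurable
      (FunctionSpaces.Torus.stLift (0 : ℝ → UnitAddTorus (Fin 3) → EuclideanSpace ℝ (Fin 3)))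
      (volume.restrict (Ioi 0 ×ˢ univ)) :=
    aestronglyMeasurable_const (b := (0 : EuclideanSpace ℝ (Fin 3)))
  have hf₂ : ∀ T : ℝ, 0 < T → ∫⁻ t in Ioo 0 T,
      ∫⁻ x, ‖(0 : ℝ → UnitAddTorus (Fin 3) → EuclideanSpace ℝ (Fin 3)) t x‖ₑ ^ 2 < ⊤ :=
    fun T _ => by simp
  obtain ⟨φ, hφ, u, hum, hu, hc⟩ := hS.exists_limitField hν hu₀ hfm hf₂
  -- the limit coefficients are in the shear class for `t ≥ 0`
  have hl2 : ∀ t, 0 ≤ t → ∀ k : Fin 3 → ℤ, k 2 ≠ 0 →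
      mFourierCoeff (FunctionSpaces.EuclideanSpace.complexify ∘ u t) k = 0 := by
    intro t ht k hk
    refine tendsto_nhds_unique (hc t ht k) ?_
    have h : (fun j => mFourierCoeff (FunctionSpaces.EuclideanSpace.complexify ∘ U (φ j) t) k) =
        fun _ => 0 := funext fun j => (hU (φ j) t ht).1 k hk
    rw [h]
    exact tendsto_const_nhds
  have hlj : ∀ (j : Fin 3) (t : ℝ), 0 ≤ t → ∀ k : Fin 3 → ℤ,
      (∀ n, mFourierCoeff (FunctionSpaces.EuclideanSpace.complexify ∘ U n t) k j = 0) →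
      mFourierCoeff (FunctionSpaces.EuclideanSpace.complexify ∘ u t) k j = 0 := by
    intro j t ht k hUj
    have h1 := ((EuclideanSpace.proj j : EuclideanSpace ℂ (Fin 3) →L[ℂ] ℂ).continuous.tendsto _).comp
      (hc t ht k)
    have h2 : ((EuclideanSpace.proj j : EuclideanSpace ℂ (Fin 3) →L[ℂ] ℂ) ∘ fun n =>
        mFourierCoeff (FunctionSpaces.EuclideanSpace.complexify ∘ U (φ n) t) k) = fun _ => 0 :=
      funext fun n => hUj (φ n)
    rw [h2] at h1
    exact tendsto_nhds_unique h1 tendsto_const_nhds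
  have hl1 : ∀ t, 0 ≤ t → ∀ k : Fin 3 → ℤ,
      mFourierCoeff (FunctionSpaces.EuclideanSpace.complexify ∘ u t) k 1 = 0 :=
    fun t ht k => hlj 1 t ht k fun n => (hU n t ht).2.1 k
  have hl0 : ∀ t, 0 ≤ t → ∀ k : Fin 3 → ℤ, k 0 ≠ 0 →
      mFourierCoeff (FunctionSpaces.EuclideanSpace.complexify ∘ u t) k 0 = 0 :=
    fun t ht k hk => hlj 0 t ht k fun n => (hU n t ht).2.2 k hk
  -- Step 1: the `x₃`-average, an everywhere `x₃`-independent representative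
  set w : ℝ → UnitAddTorus (Fin 3) → EuclideanSpace ℝ (Fin 3) := fun t => axisAvg 2 (u t)
    with hw_def
  have hwae : ∀ t, 0 ≤ t → w t =ᵐ[volume] u t := fun t ht =>
    axisAvg_ae_eq_of_forall_translate_ae_eq ((hu t ht).integrable one_le_two)
      (translate_ae_eq_of_mFourierCoeff_eq_zero (hu t ht) (hl2 t ht))
  have hwinv : ∀ t (s : UnitAddCircle) (x : UnitAddTorus (Fin 3)), w t (x + Pi.single 2 s) = w t x :=
    fun t s x => axisAvg_add_single 2 (u t) s x
  have hwmem : ∀ t, 0 ≤ t → MemLp (w t) 2 volume := fun t ht => (hu t ht).ae_eq (hwae t ht).symm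
  have hwcoef : ∀ t, 0 ≤ t → ∀ k,
      mFourierCoeff (FunctionSpaces.EuclideanSpace.complexify ∘ w t) k =
        mFourierCoeff (FunctionSpaces.EuclideanSpace.complexify ∘ u t) k := fun t ht k =>
    FunctionSpaces.Torus.mFourierCoeff_congr_ae
      ((hwae t ht).fun_comp FunctionSpaces.EuclideanSpace.complexify) k
  have hwm : AEStronglyMeasurable (FunctionSpaces.Torus.stLift w) (volume.restrict (Ioi 0 ×ˢ univ)) :=
    aestronglyMeasurable_stLift_axisAvg hum 2
  have hiw : ∀ t, 0 ≤ t → Integrable (FunctionSpaces.EuclideanSpace.complexify ∘ w t) volume :=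
    fun t ht => integrable_complexify_comp ((hwmem t ht).integrable one_le_two)
  -- Step 2: the second component of `w t` is a.e. zero
  have hw1ae : ∀ t, 0 ≤ t → ∀ᵐ x ∂volume, w t x 1 = 0 := by
    intro t ht
    set p : UnitAddTorus (Fin 3) → EuclideanSpace ℝ (Fin 3) := fun x => !₂[0, w t x 1, 0]
      with hp_def
    have hpmem : MemLp p 2 volume := by
      refine MemLp.of_eval_piLp fun j => ?_
      fin_cases j
      · simp [hp_def]
      · simpa [hp_def] using (hwmem t ht).eval_piLp 1
      · simp [hp_def]
    have hip : Integrable (FunctionSpaces.EuclideanSpace.complexify ∘ p) volume :=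
      integrable_complexify_comp (hpmem.integrable one_le_two)
    have hpcoef : ∀ k, mFourierCoeff (FunctionSpaces.EuclideanSpace.complexify ∘ p) k =
        mFourierCoeff (FunctionSpaces.EuclideanSpace.complexify ∘
          (0 : UnitAddTorus (Fin 3) → EuclideanSpace ℝ (Fin 3))) k := by
      intro k
      have hz : mFourierCoeff (FunctionSpaces.EuclideanSpace.complexify ∘
          (0 : UnitAddTorus (Fin 3) → EuclideanSpace ℝ (Fin 3))) k = 0 := by
        have h : FunctionSpaces.EuclideanSpace.complexify ∘
            (0 : UnitAddTorus (Fin 3) → EuclideanSpace ℝ (Fin 3)) =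
            fun _ => (0 : EuclideanSpace ℂ (Fin 3)) := by
          funext x; simp
        rw [h, mFourierCoeff_fun_zero]
      have hp0 : (fun x => (FunctionSpaces.EuclideanSpace.complexify ∘ p) x 0) = fun _ => (0 : ℂ) := by
        funext x; simp [hp_def]
      have hp1 : (fun x => (FunctionSpaces.EuclideanSpace.complexify ∘ p) x 1) =
          fun x => (FunctionSpaces.EuclideanSpace.complexify ∘ w t) x 1 := by
        funext x; simp [hp_def]
      have hp2 : (fun x => (FunctionSpaces.EuclideanSpace.complexify ∘ p) x 2) = fun _ => (0 : ℂ) := by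
        funext x; simp [hp_def]
      have e0 : mFourierCoeff (FunctionSpaces.EuclideanSpace.complexify ∘ p) k 0 = 0 := by
        rw [mFourierCoeff_apply_euclidean hip k 0, hp0, mFourierCoeff_fun_zero]
      have e1 : mFourierCoeff (FunctionSpaces.EuclideanSpace.complexify ∘ p) k 1 = 0 := by
        rw [mFourierCoeff_apply_euclidean hip k 1, hp1, ← mFourierCoeff_apply_euclidean (hiw t ht) k 1,
          hwcoef t ht k, hl1 t ht k]
      have e2 : mFourierCoeff (FunctionSpaces.EuclideanSpace.complexify ∘ p) k 2 = 0 := by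
        rw [mFourierCoeff_apply_euclidean hip k 2, hp2, mFourierCoeff_fun_zero]
      rw [hz]
      ext j
      fin_cases j
      · simpa using e0
      · simpa using e1
      · simpa using e2
    have hpae : p =ᵐ[volume] (0 : UnitAddTorus (Fin 3) → EuclideanSpace ℝ (Fin 3)) :=
      ae_eq_of_mFourierCoeff_complexify_eq hpmem MemLp.zero hpcoef
    filter_upwards [hpae] with x hx
    have h := congrArg (fun v : EuclideanSpace ℝ (Fin 3) => v 1) hx
    simpa [hp_def] using h
  -- Step 3: the first component, averaged along the axis `0`
  set q : ℝ → UnitAddTorus (Fin 3) → EuclideanSpace ℝ (Fin 3) := fun t x => !₂[w t x 0, 0, 0]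
    with hq_def
  have hqmem : ∀ t, 0 ≤ t → MemLp (q t) 2 volume := fun t ht => by
    refine MemLp.of_eval_piLp fun j => ?_
    fin_cases j
    · simpa [hq_def] using (hwmem t ht).eval_piLp 0
    · simp [hq_def]
    · simp [hq_def]
  have hqcoef : ∀ t, 0 ≤ t → ∀ k : Fin 3 → ℤ, k 0 ≠ 0 →
      mFourierCoeff (FunctionSpaces.EuclideanSpace.complexify ∘ q t) k = 0 := by
    intro t ht k hk
    have hiq : Integrable (FunctionSpaces.EuclideanSpace.complexify ∘ q t) volume :=
      integrable_complexify_comp ((hqmem t ht).integrable one_le_two)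
    have hq0 : (fun x => (FunctionSpaces.EuclideanSpace.complexify ∘ q t) x 0) =
        fun x => (FunctionSpaces.EuclideanSpace.complexify ∘ w t) x 0 := by
      funext x; simp [hq_def]
    have hq1 : (fun x => (FunctionSpaces.EuclideanSpace.complexify ∘ q t) x 1) = fun _ => (0 : ℂ) := by
      funext x; simp [hq_def]
    have hq2 : (fun x => (FunctionSpaces.EuclideanSpace.complexify ∘ q t) x 2) = fun _ => (0 : ℂ) := by
      funext x; simp [hq_def]
    have e0 : mFourierCoeff (FunctionSpaces.EuclideanSpace.complexify ∘ q t) k 0 = 0 := by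
      rw [mFourierCoeff_apply_euclidean hiq k 0, hq0, ← mFourierCoeff_apply_euclidean (hiw t ht) k 0,
        hwcoef t ht k, hl0 t ht k hk]
    have e1 : mFourierCoeff (FunctionSpaces.EuclideanSpace.complexify ∘ q t) k 1 = 0 := by
      rw [mFourierCoeff_apply_euclidean hiq k 1, hq1, mFourierCoeff_fun_zero]
    have e2 : mFourierCoeff (FunctionSpaces.EuclideanSpace.complexify ∘ q t) k 2 = 0 := by
      rw [mFourierCoeff_apply_euclidean hiq k 2, hq2, mFourierCoeff_fun_zero]
    ext j
    fin_cases j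
    · simpa using e0
    · simpa using e1
    · simpa using e2
  set r : ℝ → UnitAddTorus (Fin 3) → EuclideanSpace ℝ (Fin 3) := fun t => axisAvg 0 (q t)
    with hr_def
  have hrae : ∀ t, 0 ≤ t → r t =ᵐ[volume] q t := fun t ht =>
    axisAvg_ae_eq_of_forall_translate_ae_eq ((hqmem t ht).integrable one_le_two)
      (translate_ae_eq_of_mFourierCoeff_eq_zero (hqmem t ht) (hqcoef t ht))
  have hrinv0 : ∀ t (s : UnitAddCircle) (x : UnitAddTorus (Fin 3)), r t (x + Pi.single 0 s) = r t x :=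
    fun t s x => axisAvg_add_single 0 (q t) s x
  have hqinv2 : ∀ t (s : UnitAddCircle),
      (fun x : UnitAddTorus (Fin 3) => q t (x + Pi.single 2 s)) = q t := by
    intro t s
    funext x
    simp only [hq_def, hwinv]
  have hrinv2 : ∀ t (s : UnitAddCircle) (x : UnitAddTorus (Fin 3)),
      r t (x + Pi.single 2 s) = r t x := by
    intro t s x
    show axisAvg 0 (q t) (x + Pi.single 2 s) = axisAvg 0 (q t) x
    rw [axisAvg_add_right, hqinv2 t s]
  -- measurability of the lifts
  have hqm : AEStronglyMeasurable (FunctionSpaces.Torus.stLift q)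
      (volume.restrict (Ioi 0 ×ˢ univ)) := by
    have h : FunctionSpaces.Torus.stLift q =
        (fun v : EuclideanSpace ℝ (Fin 3) => (!₂[v 0, 0, 0] : EuclideanSpace ℝ (Fin 3))) ∘
          FunctionSpaces.Torus.stLift w := rfl
    rw [h]
    have hcont : Continuous fun v : EuclideanSpace ℝ (Fin 3) =>
        (!₂[v 0, 0, 0] : EuclideanSpace ℝ (Fin 3)) := by
      fun_prop
    exact hcont.comp_aestronglyMeasurable hwm
  have hrm : AEStronglyMeasurable (FunctionSpaces.Torus.stLift r)
      (volume.restrict (Ioi 0 ×ˢ univ)) :=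
    aestronglyMeasurable_stLift_axisAvg hqm 0
  -- Step 4: the shear representative
  set V : ℝ → UnitAddTorus (Fin 3) → EuclideanSpace ℝ (Fin 3) :=
    fun t x => !₂[r t x 0, 0, w t x 2] with hV_def
  have hVae : ∀ t, 0 ≤ t → V t =ᵐ[volume] u t := by
    intro t ht
    filter_upwards [hwae t ht, hrae t ht, hw1ae t ht] with x hxw hxr hx1
    rw [← hxw]
    ext j
    fin_cases j
    · simp [hV_def, hxr, hq_def]
    · simp [hV_def, hx1]
    · simp [hV_def]
  have hVm : AEStronglyMeasurable (FunctionSpaces.Torus.stLift V)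
      (volume.restrict (Ioi 0 ×ˢ univ)) := by
    have h : FunctionSpaces.Torus.stLift V = fun p =>
        (fun (y : EuclideanSpace ℝ (Fin 3)) (z : EuclideanSpace ℝ (Fin 3)) =>
          (!₂[y 0, 0, z 2] : EuclideanSpace ℝ (Fin 3))) (FunctionSpaces.Torus.stLift r p)
          (FunctionSpaces.Torus.stLift w p) := rfl
    rw [h]
    have hcont : Continuous (uncurry fun (y : EuclideanSpace ℝ (Fin 3))
        (z : EuclideanSpace ℝ (Fin 3)) => (!₂[y 0, 0, z 2] : EuclideanSpace ℝ (Fin 3))) := by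
      show Continuous fun p : EuclideanSpace ℝ (Fin 3) × EuclideanSpace ℝ (Fin 3) =>
        (!₂[p.1 0, 0, p.2 2] : EuclideanSpace ℝ (Fin 3))
      fun_prop
    exact hcont.comp_aestronglyMeasurable₂ hrm hwm
  refine ⟨φ, hφ, V, hVm, fun t ht => (hu t ht).ae_eq (hVae t ht).symm, fun t ht k => ?_, ?_⟩
  · rw [FunctionSpaces.Torus.mFourierCoeff_congr_ae
      ((hVae t ht).fun_comp FunctionSpaces.EuclideanSpace.complexify) k]
    exact hc t ht k
  · refine ⟨fun t y => r t ![0, y, 0] 0, fun t z => w t ![z 0, z 1, 0] 2, ?_⟩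
    funext t x
    have hr' : r t x = r t ![0, x 1, 0] := apply_eq_of_forall_add_single₀₂ (hrinv0 t) (hrinv2 t) x
    have hw' : w t x = w t ![x 0, x 1, 0] := apply_eq_of_forall_add_single₂ (hwinv t) x
    simp only [hV_def]
    rw [hr', hw']
    simp

end Limit

/-! ## Hopf's existence theorem in the shear class -/

/-- **Hopf's existence theorem on `𝕋³` in the class of parallel shear flows**
(Bardos–Titi–Wiedemann 2012, proof of Thm. 5: "for every fixed `ν > 0`, we obtain a Leray-Hopf
weak solution with the initial data `v₀(x)`" of the form `(u₁^ν(x₂,t), 0, u₃^ν(x₁,x₂,t))`; Hopf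
1951, §§2–4 and Robinson–Rodrigo–Sadowski 2016, Thm. 4.4, run in the closed shear subspace).
Let `ν > 0` and let `u₀ ∈ L²(𝕋³; ℝ³)` be weakly divergence free with Fourier coefficients in the
shear class (`û₀(k) = 0` for `k₂ ≠ 0`, `û₀(k)₁ = 0`, `û₀(k)₀ = 0` for `k₀ ≠ 0` — e.g. any `L²`
datum `(v₁(x₂), 0, v₃(x₁,x₂))`). Then there are `a : ℝ → 𝕋 → ℝ` and `c : ℝ → 𝕋² → ℝ` such that
`(t, x) ↦ (a t (x 1), 0, c t (x 0, x 1))` is a global Leray–Hopf weak solution of the unforced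
Navier–Stokes equations with viscosity `ν` and datum `u₀` (`Torus.IsGlobalLerayHopf ν 0 u₀`).
Real proof: `exists_isHopfGalerkinScheme_shear`, `IsHopfGalerkinScheme.exists_shear_limitField`,
`IsHopfGalerkinScheme.isLerayHopfOn_limit`. [cite: BardosTitiWiedemann2012, Thm. 5, proof] -/
theorem exists_isGlobalLerayHopf_shear (ν : ℝ) (hν : 0 < ν)
    (u₀ : UnitAddTorus (Fin 3) → EuclideanSpace ℝ (Fin 3))
    (hu₀ : MemLp u₀ 2 volume) (hdiv : FunctionSpaces.Torus.IsWeaklyDivFree u₀)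
    (h2 : ∀ k : Fin 3 → ℤ, k 2 ≠ 0 → mFourierCoeff (FunctionSpaces.EuclideanSpace.complexify ∘ u₀) k = 0)
    (h1 : ∀ k : Fin 3 → ℤ, mFourierCoeff (FunctionSpaces.EuclideanSpace.complexify ∘ u₀) k 1 = 0)
    (h0 : ∀ k : Fin 3 → ℤ, k 0 ≠ 0 → mFourierCoeff (FunctionSpaces.EuclideanSpace.complexify ∘ u₀) k 0 = 0) :
    ∃ (a : ℝ → UnitAddCircle → ℝ) (c : ℝ → UnitAddTorus (Fin 2) → ℝ),
      Torus.IsGlobalLerayHopf ν 0 u₀ fun t x => !₂[a t (x 1), 0, c t ![x 0, x 1]] := by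
  have hfm : AEStronglyMeasurable
      (FunctionSpaces.Torus.stLift (0 : ℝ → UnitAddTorus (Fin 3) → EuclideanSpace ℝ (Fin 3)))
      (volume.restrict (Ioi 0 ×ˢ univ)) :=
    aestronglyMeasurable_const (b := (0 : EuclideanSpace ℝ (Fin 3)))
  have hf₂ : ∀ T : ℝ, 0 < T → ∫⁻ t in Ioo 0 T,
      ∫⁻ x, ‖(0 : ℝ → UnitAddTorus (Fin 3) → EuclideanSpace ℝ (Fin 3)) t x‖ₑ ^ 2 < ⊤ :=
    fun T _ => by simp
  obtain ⟨N, F, U, hS, hU⟩ := exists_isHopfGalerkinScheme_shear ν hν u₀ hu₀ hdiv h2 h1 h0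
  obtain ⟨φ, hφ, u, hum, hu, hc, a, c, hu_eq⟩ :=
    hS.exists_shear_limitField hν.le hu₀ fun n t _ => hU n t
  refine ⟨a, c, ?_⟩
  rw [← hu_eq]
  exact fun T hT => (hS.comp_strictMono hφ).isLerayHopfOn_limit hν hu₀ hdiv hfm hf₂ hum hu hc hT

end NS

end Literature.Analysis.FluidPDE
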